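import Mathlib
import HarnessLib

/-!
# `NoHeavyLowerTail` (crux stmt-CriticalPhenomena-4575), antithetic vdBHK programme: THEOREM R⁺ of g52 — the sharpened rearrangement inequality for
# NESTED patterns: on an (R)-poset the templates of THEOREM C (`AntitheticWedgeConverse`) never violate (R) at the new leaf

Support file (seat `prim-ineq-gen-7` gen 52; `--supports stmt-CriticalPhenomena-4575`).  No `sorry`, no definitions.  Memo: FINDING-HUNT-g52.md §2c.

SETTING as in `AntitheticWedgeTransfer` / `AntitheticWedgeConverse`: `X` a finite partial order, `ι` an involution, `L` a down-set, (R) for `(X,L)` in quadruple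
form (`hR`).  THEOREM C shows that the (R)-functional of `(T(X;L), L_T)` on the template built from a nested pattern `𝐀` (`A₃ ⊆ A₂`) and a pattern `𝐁` equals
`R(𝐀,𝐁) − #((A₄∖A₁) ∩ (B₄∖B₁) ∩ (B₂∖B₃))` (with extremal outer sheets).  THEOREM R⁺ (`R_plus`): this quantity is still `≥ 0` whenever (R)(X,L) holds —
for every nested T-pattern `𝐀` and every T-pattern `𝐁` (the cross condition `C(B₂,B₃)` and `L` being a down-set are not even needed),
  `#(A₂ ∩ ιB₃) + #(A₃ ∩ ιB₂) + #((A₄∖A₁) ∩ (B₄∖B₁) ∩ (B₂∖B₃)) ≤ #(A₂∩B₂) + #(A₃∩B₃) + #((A₄∖A₁) ∩ (B₄∖B₁))`.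
PROOF: apply (R) to `𝐀` against the two modified patterns `𝐁∧ = (B₁, B₂∩B₃, B₃, (B₂∩B₃) ∪ ↑(B₃∩L))` and `𝐁∨ = (B₁∪B₂, B₂, B₂∪B₃, B₄)` (whose relay sets avoid
`G = B₂∖B₃`) and add: with `F = A₂∖A₃` the two instances sum to `2·target − #(F∩G) − #(F∩ιG)` up to the relay terms.  So the compression statement
'every violation of (R)(T(X;L),L_T) can be pushed into template form' (CONJECTURE T of the memo) would imply CONJECTURE H.
-/

namespace Summit.CriticalPhenomena.PercolationContinuityZ3.Theorems

open Finset

namespace AntitheticWedgeTemplateBound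

variable {X : Type*} [PartialOrder X] [DecidableEq X] [Fintype X]

omit [PartialOrder X] [Fintype X] in
/-- Splitting an `ι`-twisted intersection count along a disjoint decomposition `S = T ∪ G` (`ι` injective). -/
theorem card_inter_image_union (ι : X → X) (hι : Function.Injective ι) (A T G : Finset X) (hTG : Disjoint T G) :
    (A ∩ (T ∪ G).image ι).card = (A ∩ T.image ι).card + (A ∩ G.image ι).card := by
  rw [Finset.image_union, Finset.inter_union_distrib_left]
  apply Finset.card_union_of_disjoint
  exact Finset.disjoint_of_subset_left Finset.inter_subset_right
    (Finset.disjoint_of_subset_right Finset.inter_subset_right (Finset.disjoint_image hι |>.2 hTG))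

/-- **THEOREM R⁺.**  (R)(X,L) in quadruple form implies the sharpened inequality for NESTED first argument (`A₃ ⊆ A₂`): the relay overlap may be discounted by
the points of `B₂ ∖ B₃`. [this work] -/
theorem R_plus (ι : X → X) (hι : Function.Involutive ι) (L : Finset X)
    (hR : ∀ A₁ A₂ A₃ A₄ B₁ B₂ B₃ B₄ : Finset X,
      (∀ x y, x ≤ y → x ∈ A₁ → y ∈ A₁) → (∀ x y, x ≤ y → x ∈ A₂ → y ∈ A₂) →
      (∀ x y, x ≤ y → x ∈ A₃ → y ∈ A₃) → (∀ x y, x ≤ y → x ∈ A₄ → y ∈ A₄) →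
      (∀ x y, x ≤ y → x ∈ B₁ → y ∈ B₁) → (∀ x y, x ≤ y → x ∈ B₂ → y ∈ B₂) →
      (∀ x y, x ≤ y → x ∈ B₃ → y ∈ B₃) → (∀ x y, x ≤ y → x ∈ B₄ → y ∈ B₄) →
      A₁ ⊆ A₃ → A₂ ⊆ A₄ → (∀ x, x ∈ L → x ∈ A₃ → x ∈ A₄) → (∀ x, x ∉ L → x ∈ A₁ → x ∈ A₂) →
      (∀ x y, x ≤ y → x ∈ L → y ∉ L → x ∈ A₃ → y ∈ A₄) → (∀ x y, x ≤ y → x ∈ L → y ∉ L → x ∈ A₂ → y ∈ A₃) →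
      B₁ ⊆ B₃ → B₂ ⊆ B₄ → (∀ x, x ∈ L → x ∈ B₃ → x ∈ B₄) → (∀ x, x ∉ L → x ∈ B₁ → x ∈ B₂) →
      (∀ x y, x ≤ y → x ∈ L → y ∉ L → x ∈ B₃ → y ∈ B₄) → (∀ x y, x ≤ y → x ∈ L → y ∉ L → x ∈ B₂ → y ∈ B₃) →
      (A₂ ∩ B₃.image ι).card + (A₃ ∩ B₂.image ι).card ≤
        (A₂ ∩ B₂).card + (A₃ ∩ B₃).card + ((A₄ \ A₁) ∩ (B₄ \ B₁)).card)
    (A₁ A₂ A₃ A₄ B₁ B₂ B₃ B₄ : Finset X)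
    (hA₁ : ∀ x y, x ≤ y → x ∈ A₁ → y ∈ A₁) (hA₂ : ∀ x y, x ≤ y → x ∈ A₂ → y ∈ A₂)
    (hA₃ : ∀ x y, x ≤ y → x ∈ A₃ → y ∈ A₃) (hA₄ : ∀ x y, x ≤ y → x ∈ A₄ → y ∈ A₄)
    (hB₁ : ∀ x y, x ≤ y → x ∈ B₁ → y ∈ B₁) (hB₂ : ∀ x y, x ≤ y → x ∈ B₂ → y ∈ B₂)
    (hB₃ : ∀ x y, x ≤ y → x ∈ B₃ → y ∈ B₃) (hB₄ : ∀ x y, x ≤ y → x ∈ B₄ → y ∈ B₄)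
    (a13 : A₁ ⊆ A₃) (a24 : A₂ ⊆ A₄) (a34 : ∀ x, x ∈ L → x ∈ A₃ → x ∈ A₄) (a12 : ∀ x, x ∉ L → x ∈ A₁ → x ∈ A₂)
    (aC34 : ∀ x y, x ≤ y → x ∈ L → y ∉ L → x ∈ A₃ → y ∈ A₄) (aC23 : ∀ x y, x ≤ y → x ∈ L → y ∉ L → x ∈ A₂ → y ∈ A₃)
    (b13 : B₁ ⊆ B₃) (b24 : B₂ ⊆ B₄) (b34 : ∀ x, x ∈ L → x ∈ B₃ → x ∈ B₄) (b12 : ∀ x, x ∉ L → x ∈ B₁ → x ∈ B₂)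
    (bC34 : ∀ x y, x ≤ y → x ∈ L → y ∉ L → x ∈ B₃ → y ∈ B₄)
    (hnest : A₃ ⊆ A₂) :
    (A₂ ∩ B₃.image ι).card + (A₃ ∩ B₂.image ι).card + ((A₄ \ A₁) ∩ (B₄ \ B₁) ∩ (B₂ \ B₃)).card ≤
      (A₂ ∩ B₂).card + (A₃ ∩ B₃).card + ((A₄ \ A₁) ∩ (B₄ \ B₁)).card := by
  classical
  -- the two modified second arguments
  set U : Finset X := Finset.univ.filter (fun y => ∃ x ∈ B₃, x ∈ L ∧ x ≤ y) with hUdef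
  have memU : ∀ y, y ∈ U ↔ ∃ x ∈ B₃, x ∈ L ∧ x ≤ y := fun y => by simp [hUdef]
  have Uup : ∀ x y, x ≤ y → x ∈ U → y ∈ U := by
    intro x y hxy hx; rw [memU] at hx ⊢; obtain ⟨z, hz, hzL, hzx⟩ := hx; exact ⟨z, hz, hzL, le_trans hzx hxy⟩
  have UsubB₃ : ∀ y, y ∈ U → y ∈ B₃ := by
    intro y hy; rw [memU] at hy; obtain ⟨z, hz, _, hzy⟩ := hy; exact hB₃ z y hzy hz
  have UsubB₄ : ∀ y, y ∈ U → y ∈ B₄ := by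
    intro y hy; rw [memU] at hy; obtain ⟨z, hz, hzL, hzy⟩ := hy
    by_cases hyL : y ∈ L
    · exact b34 y hyL (hB₃ z y hzy hz)
    · exact bC34 z y hzy hzL hyL hz
  -- instance 1: 𝐁∧ = (B₁, B₂ ∩ B₃, B₃, (B₂ ∩ B₃) ∪ U)
  have h1 := hR A₁ A₂ A₃ A₄ B₁ (B₂ ∩ B₃) B₃ ((B₂ ∩ B₃) ∪ U) hA₁ hA₂ hA₃ hA₄ hB₁
    (fun x y hxy hx => Finset.mem_inter.2 ⟨hB₂ x y hxy (Finset.mem_inter.1 hx).1, hB₃ x y hxy (Finset.mem_inter.1 hx).2⟩) hB₃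
    (fun x y hxy hx => by
      rcases Finset.mem_union.1 hx with hx | hx
      · exact Finset.mem_union.2 (Or.inl (Finset.mem_inter.2 ⟨hB₂ x y hxy (Finset.mem_inter.1 hx).1, hB₃ x y hxy (Finset.mem_inter.1 hx).2⟩))
      · exact Finset.mem_union.2 (Or.inr (Uup x y hxy hx)))
    a13 a24 a34 a12 aC34 aC23
    b13 Finset.subset_union_left (fun x hxL hx => Finset.mem_union.2 (Or.inr ((memU x).2 ⟨x, hx, hxL, le_rfl⟩)))
    (fun x hxL hx => Finset.mem_inter.2 ⟨b12 x hxL hx, b13 hx⟩)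
    (fun x y hxy hxL hyL hx => Finset.mem_union.2 (Or.inr ((memU y).2 ⟨x, hx, hxL, hxy⟩)))
    (fun x y hxy _ _ hx => hB₃ x y hxy (Finset.mem_inter.1 hx).2)
  -- instance 2: 𝐁∨ = (B₁ ∪ B₂, B₂, B₂ ∪ B₃, B₄)
  have h2 := hR A₁ A₂ A₃ A₄ (B₁ ∪ B₂) B₂ (B₂ ∪ B₃) B₄ hA₁ hA₂ hA₃ hA₄
    (fun x y hxy hx => by
      rcases Finset.mem_union.1 hx with hx | hx
      · exact Finset.mem_union.2 (Or.inl (hB₁ x y hxy hx))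
      · exact Finset.mem_union.2 (Or.inr (hB₂ x y hxy hx)))
    hB₂
    (fun x y hxy hx => by
      rcases Finset.mem_union.1 hx with hx | hx
      · exact Finset.mem_union.2 (Or.inl (hB₂ x y hxy hx))
      · exact Finset.mem_union.2 (Or.inr (hB₃ x y hxy hx)))
    hB₄ a13 a24 a34 a12 aC34 aC23
    (by
      intro x hx
      rcases Finset.mem_union.1 hx with hx | hx
      · exact Finset.mem_union.2 (Or.inr (b13 hx))
      · exact Finset.mem_union.2 (Or.inl hx))
    b24
    (fun x hxL hx => by
      rcases Finset.mem_union.1 hx with hx | hx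
      · exact b24 hx
      · exact b34 x hxL hx)
    (fun x hxL hx => by
      rcases Finset.mem_union.1 hx with hx | hx
      · exact b12 x hxL hx
      · exact hx)
    (fun x y hxy hxL hyL hx => by
      rcases Finset.mem_union.1 hx with hx | hx
      · exact b24 (hB₂ x y hxy hx)
      · exact bC34 x y hxy hxL hyL hx)
    (fun x y hxy _ _ hx => Finset.mem_union.2 (Or.inl (hB₂ x y hxy hx)))
  -- cardinality bookkeeping
  have hinj : Function.Injective ι := hι.injective
  have dG : Disjoint (B₂ ∩ B₃) (B₂ \ B₃) := by
    rw [Finset.disjoint_left]; intro x hx hx'; exact (Finset.mem_sdiff.1 hx').2 (Finset.mem_inter.1 hx).2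
  have eB₂ : (B₂ ∩ B₃) ∪ (B₂ \ B₃) = B₂ := by
    ext x; simp only [Finset.mem_union, Finset.mem_inter, Finset.mem_sdiff]; tauto
  have dG' : Disjoint B₃ (B₂ \ B₃) := Finset.disjoint_sdiff
  have eB₂₃ : B₃ ∪ (B₂ \ B₃) = B₂ ∪ B₃ := by rw [Finset.union_comm, Finset.sdiff_union_self_eq_union]
  have c1 : (A₃ ∩ B₂.image ι).card = (A₃ ∩ (B₂ ∩ B₃).image ι).card + (A₃ ∩ (B₂ \ B₃).image ι).card := by
    rw [← card_inter_image_union ι hinj A₃ _ _ dG, eB₂]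
  have c2 : (A₂ ∩ (B₂ ∪ B₃).image ι).card = (A₂ ∩ B₃.image ι).card + (A₂ ∩ (B₂ \ B₃).image ι).card := by
    rw [← card_inter_image_union ι hinj A₂ _ _ dG', eB₂₃]
  have c3 : (A₂ ∩ B₂).card = (A₂ ∩ (B₂ ∩ B₃)).card + (A₂ ∩ (B₂ \ B₃)).card := by
    rw [← Finset.card_union_of_disjoint (Finset.disjoint_of_subset_left Finset.inter_subset_right
      (Finset.disjoint_of_subset_right Finset.inter_subset_right dG)), ← Finset.inter_union_distrib_left, eB₂]
  have c4 : (A₃ ∩ (B₂ ∪ B₃)).card = (A₃ ∩ B₃).card + (A₃ ∩ (B₂ \ B₃)).card := by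
    rw [← Finset.card_union_of_disjoint (Finset.disjoint_of_subset_left Finset.inter_subset_right
      (Finset.disjoint_of_subset_right Finset.inter_subset_right dG')), ← Finset.inter_union_distrib_left, eB₂₃]
  -- the relay terms of the modified patterns avoid G = B₂ ∖ B₃
  have c5 : ((A₄ \ A₁) ∩ (((B₂ ∩ B₃) ∪ U) \ B₁)).card + ((A₄ \ A₁) ∩ (B₄ \ B₁) ∩ (B₂ \ B₃)).card ≤ ((A₄ \ A₁) ∩ (B₄ \ B₁)).card := by
    rw [← Finset.card_union_of_disjoint]
    · apply Finset.card_le_card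
      intro x hx
      rcases Finset.mem_union.1 hx with hx | hx
      · rw [Finset.mem_inter, Finset.mem_sdiff] at hx ⊢
        refine ⟨hx.1, Finset.mem_sdiff.2 ⟨?_, (Finset.mem_sdiff.1 hx.2).2⟩⟩
        rcases Finset.mem_union.1 (Finset.mem_sdiff.1 hx.2).1 with h | h
        · exact b24 (Finset.mem_inter.1 h).1
        · exact UsubB₄ x h
      · exact (Finset.mem_inter.1 hx).1
    · rw [Finset.disjoint_left]
      intro x hx hx'
      have hxG := (Finset.mem_sdiff.1 (Finset.mem_inter.1 hx').2)
      rcases Finset.mem_union.1 (Finset.mem_sdiff.1 (Finset.mem_inter.1 hx).2).1 with h | h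
      · exact hxG.2 (Finset.mem_inter.1 h).2
      · exact hxG.2 (UsubB₃ x h)
  have c6 : ((A₄ \ A₁) ∩ (B₄ \ (B₁ ∪ B₂))).card + ((A₄ \ A₁) ∩ (B₄ \ B₁) ∩ (B₂ \ B₃)).card ≤ ((A₄ \ A₁) ∩ (B₄ \ B₁)).card := by
    rw [← Finset.card_union_of_disjoint]
    · apply Finset.card_le_card
      intro x hx
      rcases Finset.mem_union.1 hx with hx | hx
      · rw [Finset.mem_inter, Finset.mem_sdiff] at hx ⊢
        exact ⟨hx.1, Finset.mem_sdiff.2 ⟨(Finset.mem_sdiff.1 hx.2).1, fun h => (Finset.mem_sdiff.1 hx.2).2 (Finset.mem_union.2 (Or.inl h))⟩⟩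
      · exact (Finset.mem_inter.1 hx).1
    · rw [Finset.disjoint_left]
      intro x hx hx'
      have hxG := (Finset.mem_sdiff.1 (Finset.mem_inter.1 hx').2)
      exact (Finset.mem_sdiff.1 (Finset.mem_inter.1 hx).2).2 (Finset.mem_union.2 (Or.inr hxG.1))
  -- nestedness: the G-counts of A₃ are at most those of A₂
  have c7 : (A₃ ∩ (B₂ \ B₃)).card ≤ (A₂ ∩ (B₂ \ B₃)).card :=
    Finset.card_le_card (Finset.inter_subset_inter hnest (Finset.Subset.refl _))
  have c8 : (A₃ ∩ (B₂ \ B₃).image ι).card ≤ (A₂ ∩ (B₂ \ B₃).image ι).card :=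
    Finset.card_le_card (Finset.inter_subset_inter hnest (Finset.Subset.refl _))
  omega

end AntitheticWedgeTemplateBound

end Summit.CriticalPhenomena.PercolationContinuityZ3.Theorems
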